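import Summits.AtomisticToContinuum.HydrodynamicLimit.Theorems.AnnealedZeroHorizonDefs
import Summits.AtomisticToContinuum.HydrodynamicLimit.Theorems.CollisionIsometryCLTMacroClosureStubThermoCoercive

/-!
# Route `AnnealedZeroHorizon`, crux `AnnealedWeakStrong` (stmt-AtomisticToContinuum-9258), line `registered` —
# stub S3a `stub_hsRelEtaCoercive`, part A: calculus of the hard-sphere relative entropy on the cone

Support file (`--supports stmt-AtomisticToContinuum-9258`, registered helper stub
`hsRelEtaConeLower : Sig.hsRelEtaConeLower`, the packaged interface of this part) for the stub
`stub_hsRelEtaCoercive` (pointwise coercivity of the Bregman divergence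
`hsRelEta σ U V̄ = η_σ(U) − η_σ(V̄) − Dη_σ(V̄)(U − V̄)` of the hard-sphere entropy `hsEta σ`). The objects of the line coincide verbatim with the vocabulary of the landed `MacroClosureLine`
thermodynamics (`hsEta = hsEntropy`, `consState = stateOf`, `hsRelEta = relEnt`), whose entropy variables
(`fderiv_hsEntropy_apply`), primitive-variable splitting (`relEnt_stateOf`) and ideal coercivity
(`stub_thermo_idealCoercive`) we reuse. New here:

* `density_excess_nonneg_all` — `T₁ + 2T₄ ≥ 0` for EVERY density of the varying state (no packing cap on it),
  once the reference packing is below `η_c e^{−(1 + 4C₁η_c)}` (adapted from `stub_thermo_clause2`);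
* `hsRelEta_physical_lower` — at physical states, `(m_I/2)·min(‖U − V̄‖², ‖U − V̄‖) ≤ hsRelEta σ U V̄`;
* `hsEta_cone_lower`, `inner_le_cone`, `radial_identity`, `hsRelEta_cone_lower` — on the WHOLE realizable
  cone `{0 ≤ ρ, 0 ≤ E, ‖m‖² ≤ 2ρE}` (Lean junk included: vacuum, cold states with `Real.log 0 = 0`),
  `E/(4ϑ) + ρ log ρ − C(V̄) ρ + r(1 + rσ³ f_ex′(rσ³)) ≤ hsRelEta σ U V̄` (linear growth in the energy; the
  radial value `−η_σ(V̄) + Dη_σ(V̄)V̄ = r Z = p̄/ϑ` is what the vacuum pays).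
-/

noncomputable section

open Set InformationTheory

namespace Summit.AtomisticToContinuum.HydrodynamicLimit.Theorems.AWS

open Literature.MathematicalPhysics.KineticTheory
open MacroClosureLine.Barycentric

/-! ### Identification with the `MacroClosureLine` vocabulary (definitional) -/

/-- `hsEta` is verbatim `MacroClosureLine.hsEntropy`. -/
theorem hsEta_eq_hsEntropy : hsEta = MacroClosureLine.hsEntropy := rfl

/-- `consState` is verbatim `MacroClosureLine.stateOf`. -/
theorem consState_eq_stateOf : consState = MacroClosureLine.stateOf := rfl

/-- `hsRelEta` is verbatim `MacroClosureLine.relEnt`. -/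
theorem hsRelEta_eq_relEnt (σ : ℝ) (U V : State) : hsRelEta σ U V = MacroClosureLine.relEnt σ U V := rfl

/-- The density entropy variable
`λ⁰ = log ρ + f_ex(ρσ³) + ρσ³ f_ex′(ρσ³) − (3/2) log θ − |u|²/(2θ) + 5/2` of the reference state. -/
def lam0 (σ ρ : ℝ) (u : V3) (θ : ℝ) : ℝ :=
  Real.log ρ + hsExcessFreeEnergy (ρ * σ ^ 3) + ρ * σ ^ 3 * deriv hsExcessFreeEnergy (ρ * σ ^ 3) -
    3 / 2 * Real.log θ - ‖u‖ ^ 2 / (2 * θ) + 5 / 2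

variable {η₀ : ℝ} {F : ℝ → ℝ}

/-- The entropy variables: `Dη_σ(V̄) V = λ⁰ V.1 + ⟪θ⁻¹u, V.2.1⟫ − θ⁻¹ V.2.2` at a dilute physical
reference state `V̄ = consState ρ u θ`. -/
theorem fderiv_hsEta_apply (hFa : AnalyticOnNhd ℝ F (Ioo (-η₀) η₀))
    (hF : EqOn hsExcessFreeEnergy F (Ico 0 η₀)) {σ ρ θ : ℝ} (u : V3) (hσ : 0 < σ) (hρ : 0 < ρ)
    (hθ : 0 < θ) (hx : ρ * σ ^ 3 < η₀) (V : State) :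
    (fderiv ℝ (hsEta σ) (consState ρ u θ)) V =
      lam0 σ ρ u θ * V.1 + inner ℝ (θ⁻¹ • u) V.2.1 - θ⁻¹ * V.2.2 := by
  rw [hsEta_eq_hsEntropy, consState_eq_stateOf]
  exact fderiv_hsEntropy_apply hFa hF u hσ hρ hθ hx V

/-- The radial identity `Dη_σ(V̄) V̄ − η_σ(V̄) = r (1 + rσ³ f_ex′(rσ³)) = r Z(rσ³)` (`= p̄/θ̄`). -/
theorem radial_identity (hFa : AnalyticOnNhd ℝ F (Ioo (-η₀) η₀))
    (hF : EqOn hsExcessFreeEnergy F (Ico 0 η₀)) {σ ρ θ : ℝ} (u : V3) (hσ : 0 < σ) (hρ : 0 < ρ)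
    (hθ : 0 < θ) (hx : ρ * σ ^ 3 < η₀) :
    (fderiv ℝ (hsEta σ) (consState ρ u θ)) (consState ρ u θ) - hsEta σ (consState ρ u θ) =
      ρ * (1 + ρ * σ ^ 3 * deriv hsExcessFreeEnergy (ρ * σ ^ 3)) := by
  rw [fderiv_hsEta_apply hFa hF u hσ hρ hθ hx, hsEta_eq_hsEntropy, consState_eq_stateOf,
    hsEntropy_stateOf σ hρ.ne']
  simp only [lam0, stateOf_fst, stateOf_snd_fst, stateOf_snd_snd, real_inner_smul_left,
    real_inner_smul_right, real_inner_self_eq_norm_sq]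
  field_simp
  ring

/-! ### `T₁ + 2T₄ ≥ 0` for every density of the varying state -/

/-- **`T₁ + 2T₄ ≥ 0` without a packing cap on the varying density.** For a reference density `ρ`
with `ρσ³ < η ≤ η_c e^{−(1 + 4C₁η_c)}` and ANY `r > 0`: in the convex zone `rσ³ < η_c` this is the
Bregman divergence of the convex `r log r + 2r f_ex(rσ³)` (`density_excess_nonneg`); in the far zone
the unknown `f_ex(rσ³) ≥ 0` enters with a plus sign, the known terms are `O(C₁ η r)` and
`r log(r/ρ) ≥ r (1 + 4C₁η_c)` dominates. Adapted from `stub_thermo_clause2`. -/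
theorem density_excess_nonneg_all (hFa : AnalyticOnNhd ℝ F (Ioo (-η₀) η₀))
    (hF : EqOn hsExcessFreeEnergy F (Ico 0 η₀)) {η_c C₁ η σ ρ r : ℝ} (hc0 : 0 < η_c) (hc1 : η_c < η₀)
    (hb : ∀ x ∈ Ioo 0 η_c, -(1 / 2) ≤ 2 * x * (2 * deriv F x) + x ^ 2 * (2 * deriv (deriv F) x))
    (hC₁ : 0 ≤ C₁) (hdF : ∀ x ∈ Icc 0 η_c, |deriv F x| ≤ C₁) (hFx : ∀ x ∈ Icc 0 η_c, |F x| ≤ C₁ * x)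
    (hη0 : 0 < η) (hηle : η ≤ η_c * Real.exp (-(1 + 4 * C₁ * η_c)))
    (hσ : 0 < σ) (hρ : 0 < ρ) (hx : ρ * σ ^ 3 < η) (hr : 0 < r) :
    0 ≤ (r * Real.log r - r * Real.log ρ - r + ρ) +
      2 * (r * hsExcessFreeEnergy (r * σ ^ 3) - ρ * hsExcessFreeEnergy (ρ * σ ^ 3) -
        (hsExcessFreeEnergy (ρ * σ ^ 3) + ρ * σ ^ 3 * deriv hsExcessFreeEnergy (ρ * σ ^ 3)) *
          (r - ρ)) := by
  have hσ3 : 0 < σ ^ 3 := by positivity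
  have hηc : η ≤ η_c := hηle.trans (mul_le_of_le_one_right hc0.le
    (Real.exp_le_one_iff.2 (by nlinarith [mul_nonneg hC₁ hc0.le])))
  have hxc : ρ * σ ^ 3 < η_c := lt_of_lt_of_le hx hηc
  have hx₀ : ρ * σ ^ 3 < η₀ := hxc.trans hc1
  rcases lt_or_ge (r * σ ^ 3) η_c with hrA | hrB
  · exact density_excess_nonneg hFa hF hσ hc0 hc1.le hb ⟨hρ, (lt_div_iff₀ hσ3).2 hxc⟩
      ⟨hr, (lt_div_iff₀ hσ3).2 hrA⟩
  · have hxI : ρ * σ ^ 3 ∈ Icc 0 η_c := ⟨by positivity, hxc.le⟩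
    have hfx : hsExcessFreeEnergy (ρ * σ ^ 3) = F (ρ * σ ^ 3) := hF ⟨by positivity, hx₀⟩
    have hf'x : deriv hsExcessFreeEnergy (ρ * σ ^ 3) = deriv F (ρ * σ ^ 3) :=
      deriv_hsExcessFreeEnergy_eq hF ⟨by positivity, hx₀⟩
    have hfr : 0 ≤ hsExcessFreeEnergy (r * σ ^ 3) := HsFreeEnergyConvex.hsExcessFreeEnergy_nonneg _
    have hrρ : ρ < r := by
      by_contra h
      have : r * σ ^ 3 ≤ ρ * σ ^ 3 := mul_le_mul_of_nonneg_right (not_lt.1 h) hσ3.le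
      linarith
    have hratio : η_c / η ≤ r / ρ := by
      rw [div_le_div_iff₀ hη0 hρ]
      have i1 := mul_le_mul_of_nonneg_right hrB hρ.le
      have i2 := mul_le_mul_of_nonneg_left hx.le hr.le
      linarith only [i1, i2]
    have hlog1 : 1 + 4 * C₁ * η_c ≤ Real.log (η_c / η) := by
      have h1 : η_c / (η_c * Real.exp (-(1 + 4 * C₁ * η_c))) ≤ η_c / η :=
        div_le_div_of_nonneg_left hc0.le hη0 hηle
      have h2 : Real.log (η_c / (η_c * Real.exp (-(1 + 4 * C₁ * η_c)))) = 1 + 4 * C₁ * η_c := by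
        rw [← div_div, div_self hc0.ne', one_div, Real.log_inv, Real.log_exp]
        ring
      rw [← h2]
      exact Real.log_le_log (by positivity) h1
    have hlog2 : Real.log (η_c / η) ≤ Real.log r - Real.log ρ := by
      rw [← Real.log_div hr.ne' hρ.ne']
      exact Real.log_le_log (by positivity) hratio
    rw [hfx, hf'x]
    set x := ρ * σ ^ 3 with hx_def
    have hx0 : 0 ≤ x := by positivity
    have e2 : F x ≤ C₁ * x := (abs_le.1 (hFx _ hxI)).2
    have e3 : deriv F x ≤ C₁ := (abs_le.1 (hdF _ hxI)).2
    have hxη : x ≤ η := hx.le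
    have k0 : r * (1 + 4 * C₁ * η_c) ≤ r * (Real.log r - Real.log ρ) :=
      mul_le_mul_of_nonneg_left (hlog1.trans hlog2) hr.le
    have k1 : ρ * F x ≤ ρ * (C₁ * x) := mul_le_mul_of_nonneg_left e2 hρ.le
    have k2 : (F x + x * deriv F x) * (r - ρ) ≤ (2 * C₁ * x) * (r - ρ) := by
      refine mul_le_mul_of_nonneg_right ?_ (sub_pos.2 hrρ).le
      linarith only [e2, mul_le_mul_of_nonneg_left e3 hx0]
    have k3 : ρ * (C₁ * x) + 2 * C₁ * x * (r - ρ) ≤ 2 * C₁ * η * r := by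
      have j1 : C₁ * x * ρ ≥ 0 := by positivity
      have j2 : C₁ * x * r ≤ C₁ * η * r :=
        mul_le_mul_of_nonneg_right (mul_le_mul_of_nonneg_left hxη hC₁) hr.le
      linarith only [j1, j2]
    have k4 : 0 ≤ r * hsExcessFreeEnergy (r * σ ^ 3) := mul_nonneg hr.le hfr
    have k5 : C₁ * η * r ≤ C₁ * η_c * r :=
      mul_le_mul_of_nonneg_right (mul_le_mul_of_nonneg_left hηc hC₁) hr.le
    linarith only [k0, k1, k2, k3, k4, k5, hρ.le]

/-! ### Physical states: the two-regime lower bound -/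

/-- **Coercivity at physical states.** For a reference state `consState ρ u θ` in the compact range
(`ρ ∈ [ρm, ρM]`, `0 < θ ≤ θM`, `|u| ≤ M`) with `ρσ³ < η ≤ η_c e^{−(1 + 4C₁η_c)}` and a physical state `U`
(`ρ_U > 0`, `θ(U) > 0`) of ANY density: `(m_I/2) min(‖U − V̄‖², ‖U − V̄‖) ≤ hsRelEta σ U V̄` with the
explicit ideal constant `m_I` of `stub_thermo_idealCoercive`. -/
theorem hsRelEta_physical_lower (hFa : AnalyticOnNhd ℝ F (Ioo (-η₀) η₀))
    (hF : EqOn hsExcessFreeEnergy F (Ico 0 η₀)) {η_c C₁ η : ℝ} (hc0 : 0 < η_c) (hc1 : η_c < η₀)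
    (hb : ∀ x ∈ Ioo 0 η_c, -(1 / 2) ≤ 2 * x * (2 * deriv F x) + x ^ 2 * (2 * deriv (deriv F) x))
    (hC₁ : 0 ≤ C₁) (hdF : ∀ x ∈ Icc 0 η_c, |deriv F x| ≤ C₁) (hFx : ∀ x ∈ Icc 0 η_c, |F x| ≤ C₁ * x)
    (hη0 : 0 < η) (hηle : η ≤ η_c * Real.exp (-(1 + 4 * C₁ * η_c)))
    {ρm ρM θM M σ ρ θ : ℝ} {u : V3} (hρm : 0 < ρm) (hθM : 0 < θM) (hM : 0 ≤ M)
    (hρ1 : ρm ≤ ρ) (hρ2 : ρ ≤ ρM) (hθ : 0 < θ) (hθ2 : θ ≤ θM) (hu : ‖u‖ ≤ M)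
    (hσ : 0 < σ) (hx : ρ * σ ^ 3 < η) {U : State} (hU1 : 0 < U.1)
    (hU3 : ‖U.2.1‖ ^ 2 < 2 * U.1 * U.2.2) :
    ρm * min 1 (1 / (2 * θM)) / (256 * (max 1 (ρM * (2 + M + M ^ 2 / 2 + 3 / 2 * θM))) ^ 2) / 2 *
        min (‖U - consState ρ u θ‖ ^ 2) ‖U - consState ρ u θ‖ ≤ hsRelEta σ U (consState ρ u θ) := by
  have hρ : 0 < ρ := hρm.trans_le hρ1
  have hηc : η ≤ η_c := hηle.trans (mul_le_of_le_one_right hc0.le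
    (Real.exp_le_one_iff.2 (by nlinarith [mul_nonneg hC₁ hc0.le])))
  have hx₀ : ρ * σ ^ 3 < η₀ := (lt_of_lt_of_le hx hηc).trans hc1
  have hUch : U ∈ MacroClosureLine.chamber σ (U.1 * σ ^ 3 + 1) := ⟨hU1, by linarith, hU3⟩
  set mI := ρm * min 1 (1 / (2 * θM)) /
    (256 * (max 1 (ρM * (2 + M + M ^ 2 / 2 + 3 / 2 * θM))) ^ 2) with hmI
  have hs : 0 < MacroClosureLine.stateTemp U := stateTemp_pos_of_mem hUch
  set r := U.1 with hr_def
  set s := MacroClosureLine.stateTemp U with hs_def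
  set v : V3 := U.1⁻¹ • U.2.1 with hv_def
  have hUeq : U = MacroClosureLine.stateOf r v s := (stateOf_eta hU1.ne').symm
  rw [hsRelEta_eq_relEnt, consState_eq_stateOf, hUeq,
    relEnt_stateOf hFa hF u hσ hρ hθ hx₀ hU1.ne' v s]
  have hideal := stub_thermo_idealCoercive ρm ρM θM M hρm hθM hM ρ θ u hρ1 hρ2 hθ hθ2 hu r s v hU1 hs
  rw [← hmI] at hideal
  have hT2 : 0 ≤ 3 / 2 * r * (s / θ - 1 - (Real.log s - Real.log θ)) := by
    rw [← Real.log_div hs.ne' hθ.ne']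
    have := thermal_nonneg (div_pos hs hθ)
    positivity
  have hT3 : 0 ≤ r * ‖v - u‖ ^ 2 / (2 * θ) := by positivity
  have hT14 := density_excess_nonneg_all hFa hF hc0 hc1 hb hC₁ hdF hFx hη0 hηle hσ hρ hx hU1
  linarith only [hideal, hT2, hT3, hT14]

/-! ### The whole realizable cone: linear growth in the energy -/

/-- **Entropy floor on the cone.** For `ρ ≥ 0`, `E ≥ 0`, `|m|² ≤ 2ρE` and every `ϑ > 0`:
`ρ log ρ − (3/2)|log(2ϑ)| ρ − E/(2ϑ) ≤ η_σ(U)` — vacuum: `η_σ = 0`; cold junk (`θ(U) = 0`,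
`Real.log 0 = 0`): `η_σ = ρ log ρ + ρ f_ex ≥ ρ log ρ`; otherwise the tangent line of `log` at `2ϑ` and
`(3/2)ρθ(U) = E − |m|²/(2ρ) ≤ E`; always `ρ f_ex ≥ 0`. -/
theorem hsEta_cone_lower (σ : ℝ) {ϑ : ℝ} (hϑ : 0 < ϑ) {U : State} (hU1 : 0 ≤ U.1) (hU2 : 0 ≤ U.2.2)
    (hU3 : ‖U.2.1‖ ^ 2 ≤ 2 * U.1 * U.2.2) :
    U.1 * Real.log U.1 - 3 / 2 * |Real.log (2 * ϑ)| * U.1 - U.2.2 / (2 * ϑ) ≤ hsEta σ U := by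
  rcases hU1.eq_or_lt with h0 | hpos
  · have h : hsEta σ U = 0 := by simp [hsEta, ← h0]
    have : 0 ≤ U.2.2 / (2 * ϑ) := by positivity
    rw [h, ← h0, zero_mul, mul_zero, sub_zero, zero_sub, neg_nonpos]
    exact this
  · set T := 2 / 3 * (U.2.2 / U.1 - ‖U.2.1‖ ^ 2 / (2 * U.1 ^ 2)) with hT
    have hexp : hsEta σ U = -(3 / 2) * (U.1 * Real.log T) + U.1 * Real.log U.1 +
        U.1 * hsExcessFreeEnergy (U.1 * σ ^ 3) := by
      simp only [hsEta, hT]; ring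
    have hf : 0 ≤ U.1 * hsExcessFreeEnergy (U.1 * σ ^ 3) :=
      mul_nonneg hU1 (HsFreeEnergyConvex.hsExcessFreeEnergy_nonneg _)
    have hq : ‖U.2.1‖ ^ 2 / (2 * U.1 ^ 2) ≤ U.2.2 / U.1 := by
      rw [div_le_div_iff₀ (by positivity) hpos]; nlinarith
    have hT0 : 0 ≤ T := by simp only [hT]; linarith
    have hTE : 3 / 2 * (U.1 * T) ≤ U.2.2 := by
      have h1 : 3 / 2 * (U.1 * T) = U.2.2 - ‖U.2.1‖ ^ 2 / (2 * U.1) := by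
        simp only [hT]; field_simp
      have h2 : 0 ≤ ‖U.2.1‖ ^ 2 / (2 * U.1) := by positivity
      linarith
    have hlog : U.1 * Real.log T ≤ |Real.log (2 * ϑ)| * U.1 + U.2.2 / (3 * ϑ) := by
      rcases hT0.eq_or_lt with hT0' | hTpos
      · rw [← hT0', Real.log_zero, mul_zero]; positivity
      · have h1 : Real.log T ≤ Real.log (2 * ϑ) + T / (2 * ϑ) - 1 := by
          have := Real.log_le_sub_one_of_pos (div_pos hTpos (by positivity : (0 : ℝ) < 2 * ϑ))
          rw [Real.log_div hTpos.ne' (by positivity)] at this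
          linarith
        have h2 : U.1 * Real.log T ≤ U.1 * (Real.log (2 * ϑ) + T / (2 * ϑ) - 1) :=
          mul_le_mul_of_nonneg_left h1 hU1
        have h3 : U.1 * (T / (2 * ϑ)) ≤ U.2.2 / (3 * ϑ) := by
          rw [show U.1 * (T / (2 * ϑ)) = (3 / 2 * (U.1 * T)) / (3 * ϑ) by field_simp]
          exact div_le_div_of_nonneg_right hTE (by positivity)
        have h4 : U.1 * Real.log (2 * ϑ) ≤ |Real.log (2 * ϑ)| * U.1 := by
          rw [mul_comm]; exact mul_le_mul_of_nonneg_right (le_abs_self _) hU1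
        nlinarith
    have e : U.2.2 / (3 * ϑ) = 2 / 3 * (U.2.2 / (2 * ϑ)) := by
      field_simp
    rw [hexp]
    linarith

/-- **Momentum versus energy on the cone**: `⟪ϑ⁻¹u, m⟫ ≤ ϑ⁻¹ (E/4 + 2ρ|u|²)` when `|m|² ≤ 2ρE`
(Cauchy–Schwarz and `|u|√(2ρE) ≤ E/4 + 2ρ|u|²`). -/
theorem inner_le_cone {ϑ : ℝ} (hϑ : 0 < ϑ) (u : V3) {U : State} (hU1 : 0 ≤ U.1) (hU2 : 0 ≤ U.2.2)
    (hU3 : ‖U.2.1‖ ^ 2 ≤ 2 * U.1 * U.2.2) :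
    inner ℝ (ϑ⁻¹ • u) U.2.1 ≤ ϑ⁻¹ * (U.2.2 / 4 + 2 * U.1 * ‖u‖ ^ 2) := by
  rw [real_inner_smul_left]
  refine mul_le_mul_of_nonneg_left ?_ (inv_nonneg.2 hϑ.le)
  have h1 : inner ℝ u U.2.1 ≤ ‖u‖ * ‖U.2.1‖ := real_inner_le_norm _ _
  have hsq : (‖u‖ * ‖U.2.1‖) ^ 2 ≤ (U.2.2 / 4 + 2 * U.1 * ‖u‖ ^ 2) ^ 2 := by
    rw [mul_pow]
    have := mul_le_mul_of_nonneg_left hU3 (sq_nonneg ‖u‖)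
    nlinarith [sq_nonneg (U.2.2 / 4 - 2 * U.1 * ‖u‖ ^ 2)]
  have h2 := (abs_le_of_sq_le_sq' hsq (by positivity)).2
  linarith

/-- **Lower bound on the whole cone.** For a dilute physical reference `V̄ = consState ρ u θ`
(`ρσ³ < η₀`) and every cone state `U` (junk included):
`E/(4θ) + ρ_U log ρ_U − ((3/2)|log 2θ| + 2|u|²/θ + |λ⁰|) ρ_U + ρ(1 + ρσ³ f_ex′(ρσ³)) ≤ hsRelEta σ U V̄`. -/
theorem hsRelEta_cone_lower (hFa : AnalyticOnNhd ℝ F (Ioo (-η₀) η₀))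
    (hF : EqOn hsExcessFreeEnergy F (Ico 0 η₀)) {σ ρ θ : ℝ} (u : V3) (hσ : 0 < σ) (hρ : 0 < ρ)
    (hθ : 0 < θ) (hx : ρ * σ ^ 3 < η₀) {U : State} (hU1 : 0 ≤ U.1) (hU2 : 0 ≤ U.2.2)
    (hU3 : ‖U.2.1‖ ^ 2 ≤ 2 * U.1 * U.2.2) :
    U.2.2 / (4 * θ) + U.1 * Real.log U.1 -
        (3 / 2 * |Real.log (2 * θ)| + 2 * ‖u‖ ^ 2 / θ + |lam0 σ ρ u θ|) * U.1 +
      ρ * (1 + ρ * σ ^ 3 * deriv hsExcessFreeEnergy (ρ * σ ^ 3)) ≤ hsRelEta σ U (consState ρ u θ) := by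
  have hsplit : hsRelEta σ U (consState ρ u θ) = hsEta σ U +
      ((fderiv ℝ (hsEta σ) (consState ρ u θ)) (consState ρ u θ) - hsEta σ (consState ρ u θ)) -
      (fderiv ℝ (hsEta σ) (consState ρ u θ)) U := by
    rw [hsRelEta, map_sub]; ring
  rw [hsplit, radial_identity hFa hF u hσ hρ hθ hx, fderiv_hsEta_apply hFa hF u hσ hρ hθ hx U]
  have hent := hsEta_cone_lower σ hθ hU1 hU2 hU3
  have hmom := inner_le_cone hθ u hU1 hU2 hU3
  have hlam : lam0 σ ρ u θ * U.1 ≤ |lam0 σ ρ u θ| * U.1 :=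
    mul_le_mul_of_nonneg_right (le_abs_self _) hU1
  have e1 : θ⁻¹ * (U.2.2 / 4 + 2 * U.1 * ‖u‖ ^ 2) = U.2.2 / (4 * θ) + 2 * ‖u‖ ^ 2 / θ * U.1 := by
    field_simp
  have e2 : θ⁻¹ * U.2.2 = U.2.2 / (4 * θ) + U.2.2 / (2 * θ) + U.2.2 / (4 * θ) := by
    field_simp; ring
  nlinarith [hent, hmom, hlam, e1, e2]

/-! ### Registered helper stub: the packaged interface of part A -/

/-- **Helper stub `hsRelEtaConeLower` (part A of S3a `stub_hsRelEtaCoercive`).** There are a packing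
threshold `η₁ > 0` and a constant `C₁ ≥ 0` with `η₁ C₁ ≤ 1/4` such that: (a) `|f_ex(x)| ≤ C₁ x` and
`|f_ex′(x)| ≤ C₁` for `0 < x < η₁`; (b) for every `σ > 0`, every physical reference state
`V̄ = consState ρ u θ` (`ρ, θ > 0`, `ρσ³ < η₁`) and every state `U` of the realizable cone
`{0 ≤ ρ_U, 0 ≤ E, ‖m‖² ≤ 2ρ_U E}` (Lean junk included),
`E/(4θ) + ρ_U log ρ_U − ((3/2)|log 2θ| + 2|u|²/θ + |λ⁰|) ρ_U + ρ (1 + ρσ³ f_ex′(ρσ³)) ≤ hsRelEta σ U V̄`;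
(c) for reference states in a compact range (`ρ ∈ [ρm, ρM]`, `0 < θ ≤ θM`, `|u| ≤ M`, `ρσ³ < η₁`) and
PHYSICAL `U` of any density, `(m_I/2)·min(‖U − V̄‖², ‖U − V̄‖) ≤ hsRelEta σ U V̄` with the explicit ideal
constant `m_I = ρm min(1, 1/(2θM)) / (256 max(1, ρM(2 + M + M²/2 + (3/2)θM))²)`. -/
def Sig.hsRelEtaConeLower : Prop :=
  ∃ η₁ C₁ : ℝ, 0 < η₁ ∧ 0 ≤ C₁ ∧ η₁ * C₁ ≤ 1 / 4 ∧
    (∀ x : ℝ, 0 < x → x < η₁ →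
      |hsExcessFreeEnergy x| ≤ C₁ * x ∧ |deriv hsExcessFreeEnergy x| ≤ C₁) ∧
    (∀ (σ ρ θ : ℝ) (u : V3), 0 < σ → 0 < ρ → 0 < θ → ρ * σ ^ 3 < η₁ →
      ∀ U : State, 0 ≤ U.1 → 0 ≤ U.2.2 → ‖U.2.1‖ ^ 2 ≤ 2 * U.1 * U.2.2 →
        U.2.2 / (4 * θ) + U.1 * Real.log U.1 -
            (3 / 2 * |Real.log (2 * θ)| + 2 * ‖u‖ ^ 2 / θ + |lam0 σ ρ u θ|) * U.1 +
          ρ * (1 + ρ * σ ^ 3 * deriv hsExcessFreeEnergy (ρ * σ ^ 3)) ≤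
        hsRelEta σ U (consState ρ u θ)) ∧
    (∀ (ρm ρM θM M : ℝ), 0 < ρm → 0 < θM → 0 ≤ M →
      ∀ (σ ρ θ : ℝ) (u : V3), 0 < σ → ρm ≤ ρ → ρ ≤ ρM → 0 < θ → θ ≤ θM → ‖u‖ ≤ M →
        ρ * σ ^ 3 < η₁ → ∀ U : State, 0 < U.1 → ‖U.2.1‖ ^ 2 < 2 * U.1 * U.2.2 →
          ρm * min 1 (1 / (2 * θM)) / (256 * (max 1 (ρM * (2 + M + M ^ 2 / 2 + 3 / 2 * θM))) ^ 2) /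
              2 * min (‖U - consState ρ u θ‖ ^ 2) ‖U - consState ρ u θ‖ ≤
            hsRelEta σ U (consState ρ u θ))

/-- **Registered helper stub `hsRelEtaConeLower`**: the threshold is
`η₁ = min(η_c e^{−(1 + 4C₁η_c)}, 1/(4(C₁ + 1)))` for the convexity radius `η_c` and the derivative
bound `C₁` of the landed `HsEosLowDensity` witness (`eos_data`, `exists_convexity_radius`,
`exists_deriv_bound`). -/
theorem hsRelEtaConeLower : Sig.hsRelEtaConeLower := by
  obtain ⟨η₀, hη₀, F, hFa, hF, hF0, -⟩ := MacroClosureLine.Barycentric.eos_data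
  obtain ⟨η_c, hc0, hc1, hb⟩ := exists_convexity_radius hη₀ hFa
  obtain ⟨C₁, hC₁, hdF, hFx⟩ := exists_deriv_bound hFa hF0 hc0 hc1
  set η₁ := min (η_c * Real.exp (-(1 + 4 * C₁ * η_c))) (1 / (4 * (C₁ + 1))) with hη₁_def
  have hη₁0 : 0 < η₁ := by positivity
  have hηle : η₁ ≤ η_c * Real.exp (-(1 + 4 * C₁ * η_c)) := min_le_left _ _
  have hηc : η₁ ≤ η_c := hηle.trans (mul_le_of_le_one_right hc0.le
    (Real.exp_le_one_iff.2 (by nlinarith [mul_nonneg hC₁ hc0.le])))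
  have hηC : η₁ * C₁ ≤ 1 / 4 := by
    have h1 : η₁ * C₁ ≤ 1 / (4 * (C₁ + 1)) * C₁ :=
      mul_le_mul_of_nonneg_right (min_le_right _ _) hC₁
    have h2 : 1 / (4 * (C₁ + 1)) * C₁ ≤ 1 / 4 := by
      rw [div_mul_eq_mul_div, one_mul, div_le_div_iff₀ (by positivity) (by positivity)]
      nlinarith
    exact h1.trans h2
  refine ⟨η₁, C₁, hη₁0, hC₁, hηC, fun x hx0 hx1 => ?_, fun σ ρ θ u hσ hρ hθ hx U hU1 hU2 hU3 => ?_,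
    fun ρm ρM θM M hρm hθM hM σ ρ θ u hσ hρ1 hρ2 hθ hθ2 hu hx U hU1 hU3 => ?_⟩
  · have hxo : x ∈ Ioo 0 η₀ := ⟨hx0, (hx1.trans_le hηc).trans hc1⟩
    have hxI : x ∈ Icc 0 η_c := ⟨hx0.le, (hx1.trans_le hηc).le⟩
    rw [hF ⟨hx0.le, hxo.2⟩, deriv_hsExcessFreeEnergy_eq hF hxo]
    exact ⟨hFx x hxI, hdF x hxI⟩
  · exact hsRelEta_cone_lower hFa hF u hσ hρ hθ ((hx.trans_le hηc).trans hc1) hU1 hU2 hU3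
  · exact hsRelEta_physical_lower hFa hF hc0 hc1 hb hC₁ hdF hFx hη₁0 hηle hρm hθM hM hρ1 hρ2 hθ hθ2 hu
      hσ hx hU1 hU3

end Summit.AtomisticToContinuum.HydrodynamicLimit.Theorems.AWS

end
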